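import Mathlib.RingTheory.MvPolynomial.Ideal
import Mathlib.RingTheory.Polynomial.Quotient
import Mathlib.RingTheory.Regular.RegularSequence
import Mathlib.Algebra.MvPolynomial.CommRing
import Mathlib.RingTheory.Ideal.Quotient.Operations
import HarnessLib

/-!
# Killing variables in a polynomial ring (`MvPolynomial.killCompl`): kernel, quotient, regularity

Topic: `Literature/AlgebraicGeometry/Resolution`. Elementary facts about the quotient of a
polynomial ring `R[T_τ]` by the ideal generated by a set of variables, phrased for Mathlib's
`MvPolynomial.killCompl hf : R[T_τ] →ₐ[R] R[T_σ]` (`f : σ → τ` injective; the variables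
outside the range of `f` are sent to `0`). Used in the chart computation for the blowing up of a
regular local ring along part of a regular system of parameters (node F6 of the decomposition
of `DeJong1996NormalCrossingsBlowup`, de Jong 1996, 2.4): the exceptional divisor chart is
`(R/I)[T]`, and at a point where the variables `T_j`, `j ∈ J`, vanish they contribute `|J|`
members to a regular system of parameters. PROVED, for an arbitrary commutative ring `R`:

* `killCompl_X_of_not_mem_range`, `sub_rename_killCompl_mem`
  (`p − rename f (killCompl p) ∈ (T_a : a ∉ range f)`), **`ker_killCompl`** (the kernel of
  `killCompl hf` is the ideal of the killed variables — not in Mathlib), `killCompl_surjective`,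
  `quotientSpanXComplEquiv` (`R[T_τ]/(T_a : a ∉ range f) ≅ R[T_σ]`) and, for a set `s` of
  variables, `quotientSpanXEquiv s : R[T_τ]/(T_j : j ∈ s) ≅ R[T_{τ ∖ s}]`;
* `isSMulRegular_quotient_span_X`, `isWeaklyRegular_map_X` — **distinct variables form a weakly
  regular sequence on `R[T_τ]`** over ANY commutative ring (a surviving variable is a regular
  element of the quotient `R[T_{τ ∖ s}]`, Mathlib `MvPolynomial.isRegular_X`);
  `isDomain_quotient_span_X`, `X_not_mem_span_X` (cf. Mathlib
  `MvPolynomial.mem_ideal_span_X_image`).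

All statements are [folklore].
-/

noncomputable section

namespace Literature.AlgebraicGeometry.Resolution

universe u v w

/-- Scalar multiplication by `a ∈ A` on the quotient module `A/I` is regular as soon as the
class of `a` is a left-regular element of the ring `A/I`. [folklore] -/
theorem isSMulRegular_quotient_of_isLeftRegular {A : Type*} [CommRing A] {I : Ideal A} {a : A}
    (h : IsLeftRegular (Ideal.Quotient.mk I a)) : IsSMulRegular (A ⧸ I) a := by
  intro x y hxy
  obtain ⟨x, rfl⟩ := Ideal.Quotient.mk_surjective x
  obtain ⟨y, rfl⟩ := Ideal.Quotient.mk_surjective y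
  apply h
  have h1 : a • Ideal.Quotient.mk I x = Ideal.Quotient.mk I a * Ideal.Quotient.mk I x := by
    rw [← map_mul, ← Ideal.Quotient.mk_eq_mk, ← Submodule.Quotient.mk_smul, smul_eq_mul]
    rfl
  have h2 : a • Ideal.Quotient.mk I y = Ideal.Quotient.mk I a * Ideal.Quotient.mk I y := by
    rw [← map_mul, ← Ideal.Quotient.mk_eq_mk, ← Submodule.Quotient.mk_smul, smul_eq_mul]
    rfl
  change a • Ideal.Quotient.mk I x = a • Ideal.Quotient.mk I y at hxy
  rwa [h1, h2] at hxy

namespace MvPolynomial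

open _root_.MvPolynomial

variable {σ : Type u} {τ : Type v} {R : Type w} [CommRing R] {f : σ → τ}
  (hf : Function.Injective f)

/-! ## The kernel of `killCompl` -/

/-- `killCompl` kills the variables outside the range of `f`. [folklore] -/
theorem killCompl_X_of_not_mem_range {a : τ} (ha : a ∉ Set.range f) :
    killCompl hf (X a : MvPolynomial τ R) = 0 := by
  classical
  rw [killCompl, aeval_X, dif_neg ha]

/-- `killCompl` on a surviving variable. [folklore] -/
theorem killCompl_X_apply (b : σ) : killCompl hf (X (f b) : MvPolynomial τ R) = X b := by
  have := killCompl_rename_app hf (X b : MvPolynomial σ R)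
  rwa [rename_X] at this

/-- `killCompl hf` is surjective (`rename f` is a section). [folklore] -/
theorem killCompl_surjective : Function.Surjective (killCompl (R := R) hf) := fun q =>
  ⟨rename f q, killCompl_rename_app hf q⟩

/-- **`p` is congruent to `rename f (killCompl p)` modulo the killed variables.** [folklore] -/
theorem sub_rename_killCompl_mem (p : MvPolynomial τ R) :
    p - rename f (killCompl hf p) ∈
      Ideal.span (X '' (Set.range f)ᶜ : Set (MvPolynomial τ R)) := by
  induction p using MvPolynomial.induction_on with
  | C a =>
    rw [killCompl_C, rename_C, sub_self]
    exact Ideal.zero_mem _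
  | add p q hp hq =>
    rw [map_add, map_add]
    have : p + q - (rename f (killCompl hf p) + rename f (killCompl hf q)) =
        (p - rename f (killCompl hf p)) + (q - rename f (killCompl hf q)) := by
      ring
    rw [this]
    exact Ideal.add_mem _ hp hq
  | mul_X p a hp =>
    rw [map_mul, map_mul]
    by_cases ha : a ∈ Set.range f
    · obtain ⟨b, rfl⟩ := ha
      rw [killCompl_X_apply, rename_X]
      have : p * X (f b) - rename f (killCompl hf p) * X (f b) =
          (p - rename f (killCompl hf p)) * X (f b) := by ring
      rw [this]
      exact Ideal.mul_mem_right _ _ hp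
    · rw [killCompl_X_of_not_mem_range hf ha, map_zero, mul_zero, sub_zero]
      exact Ideal.mul_mem_left _ _ (Ideal.subset_span ⟨a, ha, rfl⟩)

/-- **The kernel of `killCompl hf` is the ideal generated by the killed variables** (those
outside the range of `f`). [folklore] -/
theorem ker_killCompl :
    RingHom.ker (killCompl (R := R) hf) = Ideal.span (X '' (Set.range f)ᶜ :
      Set (MvPolynomial τ R)) := by
  apply le_antisymm
  · intro p hp
    rw [RingHom.mem_ker] at hp
    have := sub_rename_killCompl_mem hf p
    rwa [show killCompl hf p = 0 from hp, map_zero, sub_zero] at this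
  · rw [Ideal.span_le]
    rintro _ ⟨a, ha, rfl⟩
    rw [SetLike.mem_coe, RingHom.mem_ker]
    exact killCompl_X_of_not_mem_range hf ha

/-- **`R[T_τ]/(T_a : a ∉ range f) ≅ R[T_σ]`.** [folklore] -/
def quotientSpanXComplEquiv :
    (MvPolynomial τ R ⧸ Ideal.span (X '' (Set.range f)ᶜ : Set (MvPolynomial τ R))) ≃ₐ[R]
      MvPolynomial σ R :=
  (Ideal.quotientEquivAlgOfEq R (ker_killCompl hf).symm).trans
    (Ideal.quotientKerAlgEquivOfSurjective (killCompl_surjective hf))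

/-- The isomorphism on the class of a polynomial. [folklore] -/
theorem quotientSpanXComplEquiv_mk (p : MvPolynomial τ R) :
    quotientSpanXComplEquiv hf (Ideal.Quotient.mk _ p) = killCompl hf p :=
  rfl

/-! ## Killing a set of variables -/

variable (s : Set τ)

/-- For a set `s` of variables, `s` is the complement of the range of the inclusion of
`{j // j ∉ s}`. [folklore] -/
theorem compl_range_val_not_mem : (Set.range (Subtype.val : {j : τ // j ∉ s} → τ))ᶜ = s := by
  ext a
  simp

/-- **`R[T_τ]/(T_j : j ∈ s) ≅ R[T_{τ ∖ s}]`** for a set `s` of variables. [folklore] -/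
def quotientSpanXEquiv :
    (MvPolynomial τ R ⧸ Ideal.span (X '' s : Set (MvPolynomial τ R))) ≃ₐ[R]
      MvPolynomial {j : τ // j ∉ s} R :=
  (Ideal.quotientEquivAlgOfEq R (by rw [compl_range_val_not_mem])).trans
    (quotientSpanXComplEquiv (Subtype.val_injective (p := fun j : τ => j ∉ s)))

/-- The isomorphism on the class of a polynomial. [folklore] -/
theorem quotientSpanXEquiv_mk (p : MvPolynomial τ R) :
    quotientSpanXEquiv s (Ideal.Quotient.mk _ p) =
      killCompl (Subtype.val_injective (p := fun j : τ => j ∉ s)) p :=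
  rfl

/-- The isomorphism on a surviving variable. [folklore] -/
theorem quotientSpanXEquiv_mk_X {j : τ} (hj : j ∉ s) :
    quotientSpanXEquiv s (Ideal.Quotient.mk _ (X j : MvPolynomial τ R)) = X ⟨j, hj⟩ := by
  rw [quotientSpanXEquiv_mk]
  exact killCompl_X_apply (Subtype.val_injective (p := fun j : τ => j ∉ s)) ⟨j, hj⟩

/-- The isomorphism on constants. [folklore] -/
theorem quotientSpanXEquiv_mk_C (a : R) :
    quotientSpanXEquiv s (Ideal.Quotient.mk _ (C a : MvPolynomial τ R)) = C a := by
  rw [quotientSpanXEquiv_mk, killCompl_C]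

/-- Over a domain, the quotient by a set of variables is a domain. [folklore] -/
theorem isDomain_quotient_span_X [IsDomain R] :
    IsDomain (MvPolynomial τ R ⧸ Ideal.span (X '' s : Set (MvPolynomial τ R))) :=
  (quotientSpanXEquiv s).toMulEquiv.isDomain _

/-- A surviving variable is non-zero modulo the killed ones (over a nontrivial ring; this is
also immediate from Mathlib's `MvPolynomial.mem_ideal_span_X_image`). [folklore] -/
theorem X_not_mem_span_X [Nontrivial R] {j : τ} (hj : j ∉ s) :
    (X j : MvPolynomial τ R) ∉ Ideal.span (X '' s : Set (MvPolynomial τ R)) := by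
  intro h
  have h0 : Ideal.Quotient.mk (Ideal.span (X '' s : Set (MvPolynomial τ R))) (X j) = 0 :=
    Ideal.Quotient.eq_zero_iff_mem.mpr h
  have := quotientSpanXEquiv_mk_X (R := R) s hj
  rw [h0, map_zero] at this
  exact X_ne_zero _ this.symm

/-! ## Distinct variables form a weakly regular sequence -/

/-- **A surviving variable acts regularly on the quotient by a set of variables**, over any
commutative ring: in `R[T_{τ ∖ s}]` a variable is a regular element
(`MvPolynomial.isRegular_X`). [folklore] -/
theorem isSMulRegular_quotient_span_X {j : τ} (hj : j ∉ s) :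
    IsSMulRegular (MvPolynomial τ R ⧸ Ideal.span (X '' s : Set (MvPolynomial τ R)))
      (X j : MvPolynomial τ R) := by
  apply isSMulRegular_quotient_of_isLeftRegular
  intro x y hxy
  apply (quotientSpanXEquiv (R := R) s).injective
  have h := congrArg (quotientSpanXEquiv (R := R) s) hxy
  simp only [map_mul, quotientSpanXEquiv_mk_X s hj] at h
  exact (isRegular_X (n := (⟨j, hj⟩ : {j : τ // j ∉ s}))).left h

/-- **Distinct variables form a weakly regular sequence** on `R[T_τ]` over any commutative
ring `R`: the `i`-th variable of a duplicate-free list acts regularly modulo the previous ones,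
the quotient being the polynomial ring in the remaining variables. [folklore] -/
theorem isWeaklyRegular_map_X (l : List τ) (hl : l.Nodup) :
    RingTheory.Sequence.IsWeaklyRegular (MvPolynomial τ R)
      (l.map (X : τ → MvPolynomial τ R)) := by
  rw [RingTheory.Sequence.isWeaklyRegular_iff]
  intro i hi
  -- the submodule `(T_j : j ∈ l.take i) • ⊤` is the ideal of the variables in `l.take i`
  have hlen : i < l.length := by simpa using hi
  have hideal : (Ideal.ofList ((l.map (X : τ → MvPolynomial τ R)).take i) • ⊤ :
      Submodule (MvPolynomial τ R) (MvPolynomial τ R)) =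
        Ideal.span (X '' {j | j ∈ l.take i} : Set (MvPolynomial τ R)) := by
    rw [smul_eq_mul, Ideal.mul_top, Ideal.ofList, ← List.map_take]
    congr 1
    ext p
    simp only [Set.mem_setOf_eq, List.mem_map, Set.mem_image]
  have hget : (l.map (X : τ → MvPolynomial τ R))[i] = X (l[i]'hlen) := List.getElem_map X
  rw [hget]
  have hnot : l[i]'hlen ∉ {j | j ∈ l.take i} := by
    intro hmem
    rw [Set.mem_setOf_eq] at hmem
    obtain ⟨k, hk, hkeq⟩ := List.mem_iff_getElem.mp hmem
    rw [List.length_take] at hk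
    have hk' : k < l.length := by omega
    rw [List.getElem_take] at hkeq
    have := (List.Nodup.getElem_inj_iff hl).mp hkeq
    omega
  have key := isSMulRegular_quotient_span_X (R := R) {j | j ∈ l.take i} hnot
  rwa [← hideal] at key

end MvPolynomial

end Literature.AlgebraicGeometry.Resolution

end
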